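/-
Copyright (c) 2026 the pub-hodgecm-mathlib formalisation cell (harness21).  Prover seat hodgecm-mathlib-LH4-p10 (g3): dealer LH4-plan (g12) WORD #21 «SOCKET READER for (ρ2b′-X)» —
the reader's tie leg between LH4-p04 (g4)'s T5s-RamM head and the ★ hOrg∕hOrgNV G-side clause (MAP v1 seam S7, R-class).  2026-09-04.
-/
import Summits.HodgeConjecture.HodgeConjecture.Theorems.F0P3cDyRamToricCensusSumRamM   -- ★ (LH4-p04 (g4)): `toricCensusSum_ramM` — T5s «TORIC CENSUS SUM», type RamM, range-sum form
import Mathlib.Algebra.Ring.GeomSum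
import HarnessLib

/-!
# F0 · P3c · line LH4 «(D-RAM) FOUR-FRAME» — (ρ2b′-X) road, O-Sum type RamM IN THE SHAPE OF THE ★ hOrg G-SIDE CLAUSE (socket-reader adapter, MAP v1 seam S7)

Cell `pub/hodgecm-mathlib`, crux H413 = `stmt-HodgeConjecture-24833` (helper lane `--supports stmt-HodgeConjecture-24833 --as helper`), route HCCMUnconditional; THEOREMS ONLY
(one theorem, pure `ℚ`-algebra; no definition, no instance, no notation, no `sorry`).  Twin of ★ p857558 `…ToricCensusSumUnrV5HOrgForm` for the M-ramified descent type: ★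
`toricCensusSum_ramM` concludes `ε·Σ = q^m·(2·Σ_{i<(jl−g)∕2+1} q^i − 2·Σ_{i<(g+s0)−(g+s0)%2} q^i)`; hOrgNV's [G]-bracket for an R-class reads `(q−1)·NV − 2(q^S − 1)` with `(q−1)·NV + 2 = 2·q^{nH+1}`,
`2·nH + g = jl` (`g = dΘ∕2`, `S = d_E − d_E%2`, `d_E = g + s0`) (heir LEAD T19-05 (1)); this file multiplies through by `q − 1` and moves `ε`: `(q − 1)·Σ = ε·q^m·(2·q^{nH+1} − 2·q^{(g+s0) − (g+s0)%2})`.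
HONEST LABEL: HC_CM is proved only modulo the 7 printed citations (2 remaining: hLiu418 = stmt-HodgeConjecture-24832, h413 = stmt-HodgeConjecture-24833) until rung 0 closes;
count-neutral arithmetic; (ρ2b′-X) stays OPEN modulo the organ package.

## References
* [Rogawski1990] J. D. Rogawski, *Automorphic Representations of Unitary Groups in Three Variables*, Ann. of Math. Stud. 123 (1990): §4.9 Prop. 4.9.1 (b) p. 55, Lemma 4.9.3 p. 56.
* [Kottwitz1986BaseChangeUnits] R. Kottwitz, *Base change for unit elements of Hecke algebras*, Compositio Math. 60 (1986), §1 pp. 240–241.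
-/

set_option autoImplicit false

namespace Summit.HodgeConjecture.HodgeConjecture.Cruxes.H413.F0P3cDyRamToricCensusSumRamMHOrgForm

open Finset
open Summit.HodgeConjecture.HodgeConjecture.Cruxes.H413.F0P3cDyRamToricCensusSumRamM (toricCensusSum_ramM)

/-- **T5s-RamM IN THE SHAPE OF THE ★ hOrg∕hOrgNV G-SIDE CLAUSE** (MAP v1 seam S7, R-class: `(q−1)·NV + 2 = 2·q^(nH+1)`, RM level letter `2·nH + g = jl`):
same binders as ★ `toricCensusSum_ramM` (LH4-p04 (g4)) plus `nH`; conclusion multiplied through by `q − 1`, `ε` on hOrg's side (`ε² = 1` from `hε`), no `Finset.range` sums: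
`(q − 1)·Σ_j Σ_a q^a·(vP − vM) = ε·q^m·(2·q^(nH+1) − 2·q^((g+s0) − (g+s0)%2))`.  Pure algebra (★ head, `geom_sum_mul` ×2).
[cite: Rogawski1990, §4.9 Prop. 4.9.1 (b) p. 55, Lemma 4.9.3 p. 56] [cite: Kottwitz1986BaseChangeUnits, §1 pp. 240–241] -/
theorem toricCensusSum_ramM_hOrgForm (q : ℕ) {g s0 jl m : ℕ} (ε : ℚ) (hq : 2 ≤ q) (hg : 1 ≤ g) (hs0 : 1 ≤ s0) (hjl : jl % 2 = g % 2)
    (hjlS : 3 * g + 2 * s0 ≤ jl + 2 + 2 * ((g + s0) % 2)) (hpar : m % 2 = (g + s0) % 2) (hmS : g + s0 - (g + s0) % 2 ≤ m + 1) (hm : m ≤ jl)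
    (hε : ε = 1 ∨ (ε = -1 ∧ jl + 2 ≤ m + 2 * g + s0))
    (nP nM vP vM : ℕ → ℕ → ℚ)
    (hnP : ∀ j a, nP j a = ((if j = 0 then (if a = 0 then 1 else 0) else if j < a then 0
      else if j - a + 1 = s0 then q ^ j else if j - a + 1 < s0 then (if a = 0 then q ^ j else 0) else if (j - a - s0) % 2 = 1 then 0
      else if a = 0 then (if 2 * g ≤ j - a - s0 then 2 else 1) * q ^ (j - (j - a - s0) / 2)
      else if j - a - s0 + 2 < 2 * g then (q - 1) * q ^ (j - 1 - (j - a - s0) / 2) else if j - a - s0 + 2 = 2 * g then (q - 2) * q ^ (j - 1 - (j - a - s0) / 2)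
      else 2 * (q - 1) * q ^ (j - 1 - (j - a - s0) / 2) : ℕ) : ℚ))
    (hnM : ∀ j a, nM j a = ((if j = 0 then (if a = 0 then 1 else 0) else if j < a then 0
      else if j - a + 1 = s0 then q ^ j else if j - a + 1 < s0 then (if a = 0 then q ^ j else 0) else if (j - a - s0) % 2 = 1 then 0
      else if a = 0 then (if j - a - s0 + 2 ≤ 2 * g then q ^ (j - (j - a - s0) / 2) else 0)
      else if j - a - s0 + 2 < 2 * g then (q - 1) * q ^ (j - 1 - (j - a - s0) / 2) else if j - a - s0 + 2 = 2 * g then q ^ (j - (j - a - s0) / 2) else 0 : ℕ) : ℚ))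
    (hvGen : ∀ j a, (a ≤ m ∧ (j + a ≤ m ∨ (2 * a ≤ m ∧ j + a ≤ jl))) → vP j a = nP j a ∧ vM j a = nM j a)
    (hvOff : ∀ j a, ¬ (a ≤ m ∧ (j + a ≤ m ∨ (2 * a ≤ m ∧ j + a ≤ jl))) → j + m ≠ jl + a → vP j a = 0 ∧ vM j a = 0)
    (hvTop : ∀ j a, ¬ (a ≤ m ∧ (j + a ≤ m ∨ (2 * a ≤ m ∧ j + a ≤ jl))) → j + m = jl + a →
      (vP j a = if 2 * j + (g + s0) ≤ 2 * jl + 1 ∧ (j + a + 2 ≤ m + s0 + 2 * g ∨ ε = 1) then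
          (if j + a < m + s0 then (q : ℚ) ^ j else (if 2 * g ≤ j + a - m - s0 + 1 then 2 else 1) * (q : ℚ) ^ (j - (j + a - m - s0 + 1) / 2)) else 0) ∧
      (vM j a = if 2 * j + (g + s0) ≤ 2 * jl + 1 ∧ (j + a + 2 ≤ m + s0 + 2 * g ∨ ε = -1) then
          (if j + a < m + s0 then (q : ℚ) ^ j else (if 2 * g ≤ j + a - m - s0 + 1 then 2 else 1) * (q : ℚ) ^ (j - (j + a - m - s0 + 1) / 2)) else 0))
    (nH : ℕ) (hnH : 2 * nH + g = jl) :
    ((q : ℚ) - 1) * ∑ j ∈ range (jl + 1), ∑ a ∈ range (jl + 2), (q : ℚ) ^ a * (vP j a - vM j a) =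
      ε * (q : ℚ) ^ m * (2 * (q : ℚ) ^ (nH + 1) - 2 * (q : ℚ) ^ ((g + s0) - (g + s0) % 2)) := by
  have h := toricCensusSum_ramM q ε hq hg hs0 hjl hjlS hpar hmS hm hε nP nM vP vM hnP hnM hvGen hvOff hvTop
  have hε2 : ε * ε = 1 := by
    rcases hε with rfl | ⟨rfl, -⟩ <;> norm_num
  have hnH' : (jl - g) / 2 + 1 = nH + 1 := by omega
  rw [hnH'] at h
  have hS : ∑ j ∈ range (jl + 1), ∑ a ∈ range (jl + 2), (q : ℚ) ^ a * (vP j a - vM j a) =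
      ε * ((q : ℚ) ^ m * (2 * ∑ i ∈ range (nH + 1), (q : ℚ) ^ i - 2 * ∑ i ∈ range ((g + s0) - (g + s0) % 2), (q : ℚ) ^ i)) := by
    have h2 : ε * (ε * ∑ j ∈ range (jl + 1), ∑ a ∈ range (jl + 2), (q : ℚ) ^ a * (vP j a - vM j a)) =
        ε * ((q : ℚ) ^ m * (2 * ∑ i ∈ range (nH + 1), (q : ℚ) ^ i - 2 * ∑ i ∈ range ((g + s0) - (g + s0) % 2), (q : ℚ) ^ i)) := by rw [h]
    rwa [← mul_assoc, hε2, one_mul] at h2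
  have hg1 : ((q : ℚ) - 1) * ∑ i ∈ range (nH + 1), (q : ℚ) ^ i = (q : ℚ) ^ (nH + 1) - 1 := by
    rw [mul_comm]; exact geom_sum_mul _ _
  have hg2 : ((q : ℚ) - 1) * ∑ i ∈ range ((g + s0) - (g + s0) % 2), (q : ℚ) ^ i = (q : ℚ) ^ ((g + s0) - (g + s0) % 2) - 1 := by
    rw [mul_comm]; exact geom_sum_mul _ _
  have hkey : ((q : ℚ) - 1) * (2 * ∑ i ∈ range (nH + 1), (q : ℚ) ^ i - 2 * ∑ i ∈ range ((g + s0) - (g + s0) % 2), (q : ℚ) ^ i) =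
      2 * (q : ℚ) ^ (nH + 1) - 2 * (q : ℚ) ^ ((g + s0) - (g + s0) % 2) := by
    have e : ((q : ℚ) - 1) * (2 * ∑ i ∈ range (nH + 1), (q : ℚ) ^ i - 2 * ∑ i ∈ range ((g + s0) - (g + s0) % 2), (q : ℚ) ^ i) =
        2 * (((q : ℚ) - 1) * ∑ i ∈ range (nH + 1), (q : ℚ) ^ i) - 2 * (((q : ℚ) - 1) * ∑ i ∈ range ((g + s0) - (g + s0) % 2), (q : ℚ) ^ i) := by ring
    rw [e, hg1, hg2]; ring
  rw [hS]
  calc ((q : ℚ) - 1) * (ε * ((q : ℚ) ^ m * (2 * ∑ i ∈ range (nH + 1), (q : ℚ) ^ i - 2 * ∑ i ∈ range ((g + s0) - (g + s0) % 2), (q : ℚ) ^ i)))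
        = ε * (q : ℚ) ^ m * (((q : ℚ) - 1) * (2 * ∑ i ∈ range (nH + 1), (q : ℚ) ^ i - 2 * ∑ i ∈ range ((g + s0) - (g + s0) % 2), (q : ℚ) ^ i)) := by ring
    _ = ε * (q : ℚ) ^ m * (2 * (q : ℚ) ^ (nH + 1) - 2 * (q : ℚ) ^ ((g + s0) - (g + s0) % 2)) := by rw [hkey]

end Summit.HodgeConjecture.HodgeConjecture.Cruxes.H413.F0P3cDyRamToricCensusSumRamMHOrgForm
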